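import Summits.CriticalPhenomena.PercolationContinuityZ3.Theorems.SahiBoxTP2BooleanSpins
import Summits.CriticalPhenomena.PercolationContinuityZ3.Theorems.SahiBoxTP2AffiliationConverse
import Mathlib.MeasureTheory.Constructions.Polish.Basic

/-!
# Two-valued spins: box-TP₂ ⟺ affiliated on `{0,1}^ℕ`

Support file of the Sahi cell (`prim-sahi`, typer seat, generation 12; `--supports stmt-CriticalPhenomena-4575`).

For a probability measure on `ℕ → Bool` (cylinder probabilities of an infinite-volume two-valued spin system):
FKG-lattice cylinder probabilities (⟺ box-TP₂, `isBoxTP2_iff_fkg_marginals`) ⟺ Milgrom–Weber AFFILIATION — every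
conditional law on a measurable sublattice of `{0,1}^ℕ` is positively associated (`isBoxTP2_iff_mIsAffiliated_spins`).
⇒: embed in the Hilbert cube (`spinsToHilbert`, a measurable lattice embedding by Lusin–Souslin) and pull the
affiliation of the box-TP₂ image law (`IsBoxTP2.mIsAffiliated_hilbert`) back along the rounding map.  ⇐: the image
law of an affiliated law is affiliated (sublattices and upper sets pull back along the lattice embedding), hence
box-TP₂ on the Hilbert cube (`isBoxTP2_iff_mIsAffiliated_hilbert`), and boxes of `{0,1}^ℕ` are traces of boxes.
No sorries, no new axioms.
-/

noncomputable section

namespace Summit.CriticalPhenomena.PercolationContinuityZ3.Theorems.SahiBoxTP2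

open MeasureTheory ProbabilityTheory Set Filter Topology Function Literature.Combinatorics.Sahi2008
open Literature.Probability.LatticeModels.Affiliation (mIsAffiliated)
open scoped ENNReal unitInterval

/-! ### The embedding `{0,1}^ℕ → [0,1]^ℕ` is a measurable lattice embedding -/

section Embedding

/-- `spinsToHilbert` is injective (it has the left inverse `hilbertToSpins`). [folklore] -/
theorem spinsToHilbert_injective : Injective spinsToHilbert :=
  HasLeftInverse.injective ⟨hilbertToSpins, hilbertToSpins_spinsToHilbert⟩

/-- `spinsToHilbert` is a measurable embedding (Lusin–Souslin). [folklore] -/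
theorem measurableEmbedding_spinsToHilbert : MeasurableEmbedding spinsToHilbert :=
  measurable_spinsToHilbert.measurableEmbedding spinsToHilbert_injective

/-- `ι(false ⊔ true) = …`: the embedding of a coordinate preserves joins. [folklore] -/
theorem boolToI_sup (a b : Bool) : boolToI (a ⊔ b) = boolToI a ⊔ boolToI b := by
  cases a <;> cases b <;> simp [boolToI]

/-- The embedding of a coordinate preserves meets. [folklore] -/
theorem boolToI_inf (a b : Bool) : boolToI (a ⊓ b) = boolToI a ⊓ boolToI b := by
  cases a <;> cases b <;> simp [boolToI]

/-- `spinsToHilbert` preserves joins. [folklore] -/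
theorem spinsToHilbert_sup (u v : ℕ → Bool) : spinsToHilbert (u ⊔ v) = spinsToHilbert u ⊔ spinsToHilbert v :=
  funext fun k => boolToI_sup (u k) (v k)

/-- `spinsToHilbert` preserves meets. [folklore] -/
theorem spinsToHilbert_inf (u v : ℕ → Bool) : spinsToHilbert (u ⊓ v) = spinsToHilbert u ⊓ spinsToHilbert v :=
  funext fun k => boolToI_inf (u k) (v k)

end Embedding

/-! ### Box-TP₂ ⟹ affiliated on `{0,1}^ℕ` -/

section Forward

/-- **Box-TP₂ laws on `{0,1}^ℕ` are affiliated** (pull back the affiliation of the image law on the Hilbert cube).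
[this work] -/
theorem IsBoxTP2.mIsAffiliated_spins (μ : Measure (ℕ → Bool)) [IsProbabilityMeasure μ] (hμ : IsBoxTP2 μ) :
    Literature.Probability.LatticeModels.Affiliation.mIsAffiliated μ := by
  intro L hL hLsup hLinf A B hA hB hAup hBup
  haveI : IsProbabilityMeasure (μ.map spinsToHilbert) :=
    Measure.isProbabilityMeasure_map measurable_spinsToHilbert.aemeasurable
  have haff := (hμ.map_spinsToHilbert).mIsAffiliated_hilbert (μ.map spinsToHilbert)
  -- the transported sets
  have hL' : MeasurableSet (spinsToHilbert '' L) := measurableEmbedding_spinsToHilbert.measurableSet_image.2 hL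
  have hLsup' : SupClosed (spinsToHilbert '' L) := by
    rintro _ ⟨x, hx, rfl⟩ _ ⟨y, hy, rfl⟩
    exact ⟨x ⊔ y, hLsup hx hy, spinsToHilbert_sup x y⟩
  have hLinf' : InfClosed (spinsToHilbert '' L) := by
    rintro _ ⟨x, hx, rfl⟩ _ ⟨y, hy, rfl⟩
    exact ⟨x ⊓ y, hLinf hx hy, spinsToHilbert_inf x y⟩
  have hA' : MeasurableSet (hilbertToSpins ⁻¹' A) := measurable_hilbertToSpins hA
  have hB' : MeasurableSet (hilbertToSpins ⁻¹' B) := measurable_hilbertToSpins hB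
  have hAup' : IsUpperSet (hilbertToSpins ⁻¹' A) := fun x y hxy hx => hAup (hilbertToSpins_mono hxy) hx
  have hBup' : IsUpperSet (hilbertToSpins ⁻¹' B) := fun x y hxy hx => hBup (hilbertToSpins_mono hxy) hx
  have key := haff hL' hLsup' hLinf' hA' hB' hAup' hBup'
  -- pull back along the embedding
  have hpre : ∀ S : Set (ℕ → Bool), spinsToHilbert ⁻¹' (hilbertToSpins ⁻¹' S) = S := fun S => by
    ext u; simp only [mem_preimage, hilbertToSpins_spinsToHilbert]
  have hpreL : spinsToHilbert ⁻¹' (spinsToHilbert '' L) = L := preimage_image_eq L spinsToHilbert_injective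
  have e : ∀ S : Set (ℕ → I), MeasurableSet S → μ.map spinsToHilbert S = μ (spinsToHilbert ⁻¹' S) :=
    fun S hS => Measure.map_apply measurable_spinsToHilbert hS
  rw [e _ (hA'.inter hL'), e _ (hB'.inter hL'), e _ ((hA'.inter hB').inter hL'), e _ hL', preimage_inter,
    preimage_inter, preimage_inter, preimage_inter, hpre, hpre, hpreL] at key
  exact key

end Forward

/-! ### Affiliated ⟹ box-TP₂ on `{0,1}^ℕ` -/

section Backward

/-- `ι` reflects and preserves the order coordinatewise. [folklore] -/
theorem spinsToHilbert_le_iff {u v : ℕ → Bool} : spinsToHilbert u ≤ spinsToHilbert v ↔ u ≤ v := by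
  constructor
  · intro h k
    have hk := boolFloor_mono (h k)
    simp only [spinsToHilbert, boolFloor_boolToI] at hk
    exact hk
  · exact fun h => spinsToHilbert_mono h

/-- Boxes of `{0,1}^ℕ` are traces of boxes of the Hilbert cube. [folklore] -/
theorem spinsToHilbert_preimage_Icc (a b : ℕ → Bool) :
    spinsToHilbert ⁻¹' Icc (spinsToHilbert a) (spinsToHilbert b) = Icc a b := by
  ext u
  simp only [mem_preimage, mem_Icc, spinsToHilbert_le_iff]

/-- **The image law of an affiliated law on `{0,1}^ℕ` is affiliated on the Hilbert cube** (sublattices and upper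
sets pull back along the lattice embedding). [folklore] -/
theorem affiliated_map_spinsToHilbert {μ : Measure (ℕ → Bool)}
    (hμ : Literature.Probability.LatticeModels.Affiliation.mIsAffiliated μ) :
    Literature.Probability.LatticeModels.Affiliation.mIsAffiliated (μ.map spinsToHilbert) := by
  intro L hL hLsup hLinf A B hA hB hAup hBup
  have he := measurable_spinsToHilbert
  rw [Measure.map_apply he (hA.inter hL), Measure.map_apply he (hB.inter hL),
    Measure.map_apply he ((hA.inter hB).inter hL), Measure.map_apply he hL, Set.preimage_inter, Set.preimage_inter,
    Set.preimage_inter, Set.preimage_inter]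
  refine hμ (he hL) (fun x hx y hy => ?_) (fun x hx y hy => ?_) (he hA) (he hB)
    (fun x y hxy hx => hAup (spinsToHilbert_mono hxy) hx) (fun x y hxy hx => hBup (spinsToHilbert_mono hxy) hx)
  · show spinsToHilbert (x ⊔ y) ∈ L
    rw [spinsToHilbert_sup]; exact hLsup hx hy
  · show spinsToHilbert (x ⊓ y) ∈ L
    rw [spinsToHilbert_inf]; exact hLinf hx hy

/-- Box-TP₂ of the image law on the Hilbert cube gives box-TP₂ on `{0,1}^ℕ`. [folklore] -/
theorem isBoxTP2_of_map_spinsToHilbert {μ : Measure (ℕ → Bool)} (h : IsBoxTP2 (μ.map spinsToHilbert)) :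
    IsBoxTP2 μ := by
  intro a b a' b'
  have key := h (spinsToHilbert a) (spinsToHilbert b) (spinsToHilbert a') (spinsToHilbert b')
  rw [← spinsToHilbert_inf, ← spinsToHilbert_inf, ← spinsToHilbert_sup, ← spinsToHilbert_sup] at key
  simpa only [Measure.map_apply measurable_spinsToHilbert measurableSet_Icc, spinsToHilbert_preimage_Icc] using key

/-- **Affiliated laws on `{0,1}^ℕ` are box-TP₂.** [this work] -/
theorem isBoxTP2_of_mIsAffiliated_spins (μ : Measure (ℕ → Bool)) [IsProbabilityMeasure μ]
    (hμ : Literature.Probability.LatticeModels.Affiliation.mIsAffiliated μ) : IsBoxTP2 μ := by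
  haveI : IsProbabilityMeasure (μ.map spinsToHilbert) :=
    Measure.isProbabilityMeasure_map measurable_spinsToHilbert.aemeasurable
  exact isBoxTP2_of_map_spinsToHilbert
    ((isBoxTP2_iff_mIsAffiliated_hilbert _).2 (affiliated_map_spinsToHilbert hμ))

/-- **BOX-TP₂ ⟺ AFFILIATED on `{0,1}^ℕ`.** [this work] -/
theorem isBoxTP2_iff_mIsAffiliated_spins (μ : Measure (ℕ → Bool)) [IsProbabilityMeasure μ] :
    IsBoxTP2 μ ↔ Literature.Probability.LatticeModels.Affiliation.mIsAffiliated μ :=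
  ⟨fun h => h.mIsAffiliated_spins μ, isBoxTP2_of_mIsAffiliated_spins μ⟩

/-- **FKG-lattice cylinder probabilities ⟺ affiliation on `{0,1}^ℕ`.** [this work] -/
theorem fkg_marginals_iff_mIsAffiliated_spins (μ : Measure (ℕ → Bool)) [IsProbabilityMeasure μ] :
    (∀ (d : ℕ) (x y : Fin d → Bool),
      μ.real {u | finRestrict d u = x} * μ.real {u | finRestrict d u = y} ≤
        μ.real {u | finRestrict d u = x ⊓ y} * μ.real {u | finRestrict d u = x ⊔ y}) ↔
      Literature.Probability.LatticeModels.Affiliation.mIsAffiliated μ := by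
  rw [← isBoxTP2_iff_mIsAffiliated_spins]
  refine ⟨isBoxTP2_of_fkg_marginals μ, fun h d x y => ?_⟩
  have hIcc : ∀ (a b : Fin d → Bool), MeasurableSet (Icc a b) := fun a b => (Set.toFinite _).measurableSet
  have hd := h.map_finRestrict d hIcc x x y y
  simp only [Icc_self, Measure.map_apply (measurable_finRestrict d) (measurableSet_singleton _)] at hd
  have e : ∀ z : Fin d → Bool, μ.real {u | finRestrict d u = z} = (μ (finRestrict d ⁻¹' {z})).toReal := fun z => rfl
  rw [e, e, e, e, ← ENNReal.toReal_mul, ← ENNReal.toReal_mul]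
  exact ENNReal.toReal_mono (ENNReal.mul_ne_top (measure_ne_top μ _) (measure_ne_top μ _)) hd

end Backward

end Summit.CriticalPhenomena.PercolationContinuityZ3.Theorems.SahiBoxTP2
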